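import Mathlib
import Literature.Probability.LatticeModels.GKSInequalities
import Summits.CriticalPhenomena.Ising3DConformalLimit.Theses.PrecisionLaplacian
import HarnessLib

/-!
# Crux `PrecisionLaplacian.InverseMFerromagnet` (stmt-CriticalPhenomena-4798), line `Sketch` —
# stub `stub_im_of_cofactorSign` (core B, bridge B2: "off-diagonal adjugate of the unnormalised
# second-moment matrix ≤ 0 ⇒ IM")

THEOREM-ONLY file (no definitions).  Let `S_pq := gksSum univ K C (σ_pσ_q) = ∑_ω σ_p(ω)σ_q(ω) w(ω)`
be the UNNORMALISED second-moment matrix of the pair ferromagnet and `Z := gksSum univ K C 1 > 0`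
its partition function, so that the crux's matrix is `Σ = Z⁻¹ • S`.  We have
`S = Bᴴ · diag(w) · B` with `B_{ωp} = σ_p(ω)` and `w > 0`, hence `S` is positive semidefinite and
`det S ≥ 0`.  Since `Σ⁻¹ = (det Σ)⁻¹ • adj Σ` (Mathlib's `Matrix.inv_def`), `det Σ = Z⁻ⁿ det S ≥ 0`
and `adj Σ = Z^{-(n-1)} • adj S`, the entry `(Σ⁻¹)_xy` is a product of nonnegative reals with
`(adj S)_xy`, which is `≤ 0` for `x ≠ y` by the hypothesis (the conclusion of bridge B1).
-/

namespace Summit.CriticalPhenomena.Ising3DConformalLimit.Cruxes.InverseMFerromagnet.PartialCovarianceLadder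

open Literature.Probability.LatticeModels Finset Matrix
open Summit.CriticalPhenomena.Ising3DConformalLimit.Theses.PrecisionLaplacian (InverseMFerromagnet)

variable {n m : ℕ} (K : Fin m → ℝ) (C : Fin m → Finset (Fin n))

/-- The unnormalised second-moment matrix is a congruence of the diagonal weight matrix:
`(∑_ω σ_pσ_q w)_{p,q} = Bᴴ · diag(w) · B` with `B_{ωp} = σ_p(ω)`. [folklore] -/
theorem cs2im_unnorm_eq_conj :
    (Matrix.of fun p q : Fin n => gksSum Finset.univ K C (fun ω => spinAt p ω * spinAt q ω))
      = (Matrix.of fun (ω : SpinConfig (Fin n)) (p : Fin n) => spinAt p ω)ᴴ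
          * Matrix.diagonal (fun ω => gksWeight Finset.univ K C ω)
          * (Matrix.of fun (ω : SpinConfig (Fin n)) (p : Fin n) => spinAt p ω) := by
  ext p q
  rw [Matrix.mul_apply]
  simp only [Matrix.mul_diagonal, Matrix.conjTranspose_apply, Matrix.of_apply, star_trivial, gksSum]
  exact Finset.sum_congr rfl fun ω _ => by ring

/-- The unnormalised second-moment matrix `(∑_ω σ_pσ_q w)_{p,q}` is positive semidefinite
(the weights `w = gksWeight` are positive). [folklore] -/
theorem cs2im_unnorm_posSemidef :
    (Matrix.of fun p q : Fin n =>
      gksSum Finset.univ K C (fun ω => spinAt p ω * spinAt q ω)).PosSemidef := by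
  rw [cs2im_unnorm_eq_conj K C]
  exact (Matrix.PosSemidef.diagonal fun ω => (gksWeight_pos Finset.univ K C ω).le)
    |>.conjTranspose_mul_mul_same _

/-- The crux's second-moment matrix `(⟨σ_pσ_q⟩)_{p,q}` is `Z⁻¹ •` the unnormalised one,
`Z = gksSum univ K C 1` the partition function. [folklore] -/
theorem cs2im_sigma_eq_smul :
    (Matrix.of fun (p q : Fin n) => gksExpect Finset.univ K C (fun ω => spinAt p ω * spinAt q ω))
      = (gksSum Finset.univ K C (fun _ => 1))⁻¹
          • (Matrix.of fun p q : Fin n =>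
              gksSum Finset.univ K C (fun ω => spinAt p ω * spinAt q ω)) := by
  ext p q
  simp only [Matrix.of_apply, Matrix.smul_apply, smul_eq_mul, gksExpect, div_eq_inv_mul]

/-- Registered stub `stub_im_of_cofactorSign` (core B of line `Sketch`, bridge B2): if for every
finite zero-field pair ferromagnet the off-diagonal entries of the adjugate of the UNNORMALISED
second-moment matrix `S = (gksSum univ K C (σ_pσ_q))_{p,q}` are `≤ 0`, then IM holds, i.e. the
off-diagonal entries of `Σ⁻¹`, `Σ = (⟨σ_pσ_q⟩)_{p,q} = Z⁻¹ • S`, are `≤ 0`.  Pure matrix algebra: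
`Σ⁻¹ = (det Σ)⁻¹ • adj Σ`, `det Σ = Z⁻ⁿ det S ≥ 0` (`S` is positive semidefinite) and
`adj Σ = Z^{-(n-1)} • adj S`. [folklore] -/
theorem stub_im_of_cofactorSign : (∀ (n m : ℕ) (K : Fin m → ℝ) (C : Fin m → Finset (Fin n)), (∀ i, 0 ≤ K i) → (∀ i, (C i).card = 2) → ∀ x y : Fin n, x ≠ y → (Matrix.of fun p q : Fin n => gksSum Finset.univ K C (fun ω => spinAt p ω * spinAt q ω)).adjugate x y ≤ 0) → InverseMFerromagnet := by
  intro hcs n m K C hK hC x y hxy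
  have hZ : 0 < gksSum Finset.univ K C (fun _ => 1) := gksSum_one_pos _ K C
  have hdet : 0 ≤ (Matrix.of fun p q : Fin n =>
      gksSum Finset.univ K C (fun ω => spinAt p ω * spinAt q ω)).det :=
    (cs2im_unnorm_posSemidef K C).det_nonneg
  rw [cs2im_sigma_eq_smul K C, Matrix.inv_def, Ring.inverse_eq_inv, Matrix.det_smul,
    Matrix.adjugate_smul, Matrix.smul_apply, Matrix.smul_apply, smul_eq_mul, smul_eq_mul]
  exact mul_nonpos_of_nonneg_of_nonpos
    (inv_nonneg.mpr (mul_nonneg (pow_nonneg (inv_nonneg.mpr hZ.le) _) hdet))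
    (mul_nonpos_of_nonneg_of_nonpos (pow_nonneg (inv_nonneg.mpr hZ.le) _)
      (hcs n m K C hK hC x y hxy))

end Summit.CriticalPhenomena.Ising3DConformalLimit.Cruxes.InverseMFerromagnet.PartialCovarianceLadder
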